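import Mathlib
import HarnessLib
import Summits.ValiantsHypothesis.ValiantsHypothesis.Theorems.SymmetryDialAffinePebble
import Summits.ValiantsHypothesis.ValiantsHypothesis.Theorems.SymmetryDialAffinePebbleThree

/-!
# SymmetryDial — permanent congruences from matrix symmetries (lemma ζ: the census's per certificate)

Route `SymmetryDial` (workshop `decomp-valiant`, lens 1, gen 7), item 23711, bottom piece
P′ = `AffinePebblePairs`: witness pairs need `C^{k′}`-equivalent affine matrix structures AND a certified
gap between their `0/1`-permanents.  The census (T6′-v2, NODE-g6 §8 tension (T1)) finds `C³`-equivalent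
translation-invariant pairs at `d = 8` (`n = 256`) but has no way to certify `per A ≠ per B` there: the
permanent of a `256 × 256` matrix is out of reach and `per ≡ 0 (mod 4)` throughout.  This file supplies
the certificate in kernel currency:

* `admissible A` = the permutations inside the `0/1` matrix `A` (so `per A = #admissible A`,
  `eval_perPoly_eq_card_admissible`, from `SymmetryDialAffinePebble.eval_perPoly_eq_card`);
* a SYMMETRY `ω` of `A` (`∀ i j, A (ω i, ω j) = A (i, j)`, an explicit hypothesis) acts on
  `admissible A` by conjugation (`conj_mem_admissible`);
* **`card_admissible_modEq`** (lemma ζ): if `ω ^ (p ^ n) = 1` with `p` prime then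
  `per A ≡ #{σ ∈ admissible A : σω = ωσ} (mod p)` — the fixed-point congruence for the cyclic `p`-group
  `⟨ω⟩` (Mathlib's `Equiv.Perm.card_fixedPoints_modEq`), i.e. `per A` is congruent mod `p` to the number
  of `ω`-EQUIVARIANT permutations inside `A`;
* for the group matrices `grpMat f : (x, y) ↦ f (x + y)` on `𝔽₂^d` of
  `SymmetryDialAffinePebbleThree` (p754121): every translation is a symmetry
  (`isMatSym_grp_translate`; `p = 2`) and every additive bijection `L` with `f ∘ L = f` is a symmetry
  (`isMatSym_grp_linear`), whence **`per_grp_modEq_equivariant`**: `per M_f ≡ #{σ inside M_f : σL = Lσ}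
  (mod p)` whenever `L^{p^n} = 1`.

How the census uses it (informal; NODE-g7 §5): take `f` invariant under a multiplier `L` of odd prime
order `p` (a Singer-type element of `GL_d(𝔽₂)`: `d = 6`, `p = 7`, nine orbits of size 7 on `𝔽₂^6 ∖ 0`;
`d = 8`, `p = 17`, fifteen orbits of size 17), i.e. `supp f` a union of `L`-orbits ("cyclotomic" designs,
including Dillon partial-spread bent functions for the kernel multiplications).  An `L`-equivariant `σ`
fixes `0` (the only `L`-fixed vector), so the count is `0` unless `f 0 = 1`, and is otherwise the
permanent of the small ORBIT MATRIX `N[O, O′] = #{y ∈ O′ : x_O + y ∈ supp f}` over the nonzero orbits —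
a `9 × 9` resp. `15 × 15` permanent.  Two such `f, g` with `per N_f ≢ per N_g (mod p)` have certified
different permanents at sizes where `per` itself is infeasible; at `d = 6` the congruence can be
cross-checked against the exact frontier-DP permanents.  (The `2`-adic residues, by contrast, are cheap
for Spoiler too: NODE-g7 lemma (θ).)

LADDER-Valiant rung 0.  References: the `p`-group fixed-point congruence [folklore; Mathlib
`Equiv.Perm.card_fixedPoints_modEq`]; NODE-g6/NODE-g7 of the workshop lineage.
-/

set_option linter.dupNamespace false

namespace Summit.ValiantsHypothesis.ValiantsHypothesis.Theorems.SymmetryDialPerCongruence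

open Finset Equiv
open Literature.Computability.AlgebraicComplexity (perPoly)

section General

variable {I : Type} [Fintype I] [DecidableEq I]

/-! ### 1. Permutations inside a `0/1` matrix and its symmetries -/

/-- The permutations inside the `0/1` matrix `A`: the nonzero terms of `per A`. -/
def admissible (A : I × I → Bool) : Finset (Perm I) := univ.filter fun σ => ∀ i, A (σ i, i) = true

/-- Membership in `admissible A`, unfolded. -/
theorem mem_admissible {A : I × I → Bool} {σ : Perm I} :
    σ ∈ admissible A ↔ ∀ i, A (σ i, i) = true := by
  simp [admissible]

/-- `per A = #admissible A` (the tree's `eval_perPoly_eq_card`, in this file's language). -/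
theorem eval_perPoly_eq_card_admissible (A : I × I → Bool) :
    MvPolynomial.eval (fun ij => if A ij = true then (1 : ℂ) else 0) (perPoly I ℂ) =
      ((admissible A).card : ℂ) :=
  SymmetryDialAffinePebble.eval_perPoly_eq_card A

omit [Fintype I] [DecidableEq I] in
/-- A SYMMETRY of the matrix is a simultaneous row/column permutation `ω` fixing `A`,
`∀ i j, A (ω i, ω j) = A (i, j)` (kept as an explicit hypothesis throughout); its inverse is one too. -/
theorem matSym_inv {A : I × I → Bool} {ω : Perm I} (hω : ∀ i j, A (ω i, ω j) = A (i, j)) :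
    ∀ i j, A (ω⁻¹ i, ω⁻¹ j) = A (i, j) :=
  fun i j => by rw [← hω (ω⁻¹ i) (ω⁻¹ j)]; simp

/-- Conjugation by a symmetry preserves admissibility. -/
theorem conj_mem_admissible {A : I × I → Bool} {ω σ : Perm I}
    (hω : ∀ i j, A (ω i, ω j) = A (i, j)) (hσ : σ ∈ admissible A) :
    ω * σ * ω⁻¹ ∈ admissible A := by
  rw [mem_admissible] at hσ ⊢
  intro i
  have h1 : (ω * σ * ω⁻¹) i = ω (σ (ω⁻¹ i)) := by simp [Perm.mul_apply]
  have h2 : A (ω (σ (ω⁻¹ i)), ω (ω⁻¹ i)) = true := by rw [hω]; exact hσ _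
  rw [h1]
  simpa using h2

/-! ### 2. Lemma (ζ): the fixed-point congruence for a symmetry of prime-power order -/

/-- **Lemma (ζ).** If `ω` is a symmetry of `A` with `ω ^ (p ^ n) = 1`, `p` prime, then the number of
permutations inside `A` — i.e. `per A` — is congruent mod `p` to the number of those commuting with `ω`. -/
theorem card_admissible_modEq (A : I × I → Bool) {ω : Perm I}
    (hω : ∀ i j, A (ω i, ω j) = A (i, j)) {p n : ℕ} [hp : Fact p.Prime] (hωp : ω ^ p ^ n = 1) :
    (admissible A).card ≡ ((admissible A).filter fun σ => ω * σ = σ * ω).card [MOD p] := by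
  classical
  -- conjugation by `ω` as an endomorphism of the finite type of admissible permutations
  let f : Function.End {σ : Perm I // σ ∈ admissible A} :=
    fun x => ⟨ω * x.1 * ω⁻¹, conj_mem_admissible hω x.2⟩
  have hpow : ∀ m : ℕ, (f ^ m : Function.End {σ : Perm I // σ ∈ admissible A}) = f^[m] :=
    fun m => rfl
  have hiter : ∀ (m : ℕ) (x : {σ : Perm I // σ ∈ admissible A}),
      ((f^[m]) x).1 = ω ^ m * x.1 * (ω ^ m)⁻¹ := by
    intro m
    induction m with
    | zero => intro x; simp
    | succ m ih =>
        intro x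
        rw [Function.iterate_succ_apply', show (f ((f^[m]) x)).1 = ω * ((f^[m]) x).1 * ω⁻¹ from rfl,
          ih x, pow_succ', mul_inv_rev]
        group
  have hf : f ^ p ^ n = 1 := by
    funext x
    apply Subtype.ext
    change ((f^[p ^ n]) x).1 = x.1
    rw [hiter, hωp]
    simp
  have hmod := Equiv.Perm.card_fixedPoints_modEq (f := f) hf
  have hfix : ∀ x : {σ : Perm I // σ ∈ admissible A},
      x ∈ Function.fixedPoints f ↔ ω * x.1 = x.1 * ω := fun x => by
    rw [Function.mem_fixedPoints, Function.IsFixedPt, Subtype.ext_iff]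
    exact mul_inv_eq_iff_eq_mul
  let e : Function.fixedPoints f ≃
      {σ : Perm I // σ ∈ (admissible A).filter fun σ => ω * σ = σ * ω} :=
    { toFun := fun x => ⟨x.1.1, mem_filter.2 ⟨x.1.2, (hfix x.1).1 x.2⟩⟩
      invFun := fun y => ⟨⟨y.1, (mem_filter.1 y.2).1⟩, (hfix _).2 (mem_filter.1 y.2).2⟩
      left_inv := fun x => rfl
      right_inv := fun y => rfl }
  rw [Fintype.card_congr e, Fintype.card_coe, Fintype.card_coe] at hmod
  exact hmod

/-- The same with the symmetry inverted on the other side (`σ ↦ ω⁻¹ σ ω` has the same fixed points). -/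
theorem card_admissible_modEq' (A : I × I → Bool) {ω : Perm I}
    (hω : ∀ i j, A (ω i, ω j) = A (i, j)) {p n : ℕ} [hp : Fact p.Prime] (hωp : ω ^ p ^ n = 1) :
    (((admissible A).filter fun σ => ω * σ = σ * ω).card : ZMod p) = (admissible A).card :=
  ((ZMod.natCast_eq_natCast_iff _ _ _).2 (card_admissible_modEq A hω hωp)).symm

end General

/-! ### 3. Group matrices on `𝔽₂^d`: translations and linear symmetries -/

section Grp

open SymmetryDialAffinePebble (V)
open SymmetryDialAffinePebbleThree (grpMat)

variable {d : ℕ}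

/-- `𝔽₂^d` has exponent two. -/
theorem two_nsmul_eq_zero (v : V d) : v + v = 0 := by
  funext i
  have h : ∀ a : Fin 2, a + a = 0 := by decide
  exact h (v i)

/-- Translations are symmetries of every group matrix `(x, y) ↦ f (x + y)` on `𝔽₂^d`. -/
theorem isMatSym_grp_translate (f : V d → Bool) (t : V d) (x y : V d) :
    grpMat f (Equiv.addLeft t x, Equiv.addLeft t y) = grpMat f (x, y) := by
  simp only [Equiv.coe_addLeft, grpMat]
  congr 1
  calc t + x + (t + y) = (t + t) + (x + y) := by abel
    _ = x + y := by rw [two_nsmul_eq_zero, zero_add]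

/-- An additive bijection preserving `f` is a symmetry of the group matrix of `f`. -/
theorem isMatSym_grp_linear (f : V d → Bool) (L : Perm (V d))
    (hadd : ∀ x y, L (x + y) = L x + L y) (hf : ∀ v, f (L v) = f v) (x y : V d) :
    grpMat f (L x, L y) = grpMat f (x, y) := by
  show f (L x + L y) = f (x + y)
  rw [← hadd, hf]

/-- **The census certificate.** For `f : 𝔽₂^d → {0,1}` invariant under an additive bijection `L` of
prime-power order `p^n`: `per M_f ≡ #{σ inside M_f : σL = Lσ} (mod p)`.  With `L` a multiplier of odd
prime order the right-hand side is a small orbit-matrix permanent (module docstring). -/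
theorem per_grp_modEq_equivariant (f : V d → Bool) (L : Perm (V d))
    (hadd : ∀ x y, L (x + y) = L x + L y) (hf : ∀ v, f (L v) = f v) {p n : ℕ} [Fact p.Prime]
    (hL : L ^ p ^ n = 1) :
    (admissible (grpMat f)).card ≡
      ((admissible (grpMat f)).filter fun σ => L * σ = σ * L).card [MOD p] :=
  card_admissible_modEq _ (isMatSym_grp_linear f L hadd hf) hL

/-- Parity from one translation: `per M_f ≡ #{σ inside M_f : σ τ_t = τ_t σ} (mod 2)`. -/
theorem per_grp_modEq_two_translate (f : V d → Bool) (t : V d) :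
    (admissible (grpMat f)).card ≡
      ((admissible (grpMat f)).filter
        fun σ => Equiv.addLeft t * σ = σ * Equiv.addLeft t).card [MOD 2] := by
  haveI : Fact (Nat.Prime 2) := ⟨Nat.prime_two⟩
  refine card_admissible_modEq _ (isMatSym_grp_translate f t) (n := 1) ?_
  refine Equiv.ext fun v => ?_
  show t + (t + v) = v
  rw [← add_assoc, two_nsmul_eq_zero, zero_add]

end Grp

end Summit.ValiantsHypothesis.ValiantsHypothesis.Theorems.SymmetryDialPerCongruence
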